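import Literature.IUT.HodgeArakelov.ThetaEvaluationModelEvDiagramGenuine
import Literature.IUT.HodgeArakelov.ThetaEvaluationModelEvRetractionTop
import Literature.IUT.HodgeArakelov.EtaleThetaDataOfSettingKummerTower
import Literature.IUT.HodgeArakelov.MonoThetaProjectiveBridgeEtTh

/-!
# [IUTchII] Cor. 1.12 (iii) at the model with the GENUINE [AbsTopIII]-output data: the residual input `hcU` (with the
# datum `cU`) and `hlift`/`hemb` DISCHARGED from the cyclotome tower — proof companion

Proof-only companion (abc-iut cell, D-0067 wave 4, seat abc-iut-w4-d007 gen 4; layer L6; node **IUTchII:Cor1.12(iii)**) to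
abc-iut-w4-d043's `ThetaEvaluationModelEvDiagramGenuine.lean` (`EtaleLevels.cor112_iii_model_genuine_of_tower`: the diagram
`(†μ,×μ)` for the model theta-evaluation datum of record with abc-iut-L6-t13's GENUINE producer `AbsTopMonoids.genuineOfModel` over
the MLF closure datum `(k, ℚ̄_p)`, `k/ℚ_p` finite, last arrow = the `α_×`-induced identifications; residual named inputs there:
`hcU`, `[G_{ℚ_p} : ε(D_{μ_-})] < ∞` + `hDq`/`hlift`/`hemb`, the producer's `ε`/(H1)/(H2)) — the GENUINE twin of this seat's
`ThetaEvaluationModelEvDiagramOfTower.lean` (p427891, `cor112_iii_model_of_cyclotomeTower` for a named `P₀`).  Inputs consumed BY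
NAME: this seat's `exists_cyclotomeCoefficients_of_cyclotomeTower` (p422741) on abc-iut-w4-d043's chain tower
`EtaleLevels.cyclotomeTower mods hmods`, abc-iut-w4-d043's `hlift_of_isCompact`/`hemb_of_isCompact` (p421351).  No definitions;
nothing of those files is restated.

S. Mochizuki, *Inter-universal Teichmüller theory II*, kurims manuscript (Dec. 2020), Cor. 1.12 (iii) p. 58, Ex. 1.8 (ii),(iii)
pp. 37–38 [cite: Mochizuki2012, Cor 1.12 (iii) p.58]; *The étale theta function …*, Publ. RIMS **45** (2009), §1 p. 238
"`(Ẑ(1) ≅) Δ_Θ`", Cor. 2.19 (ii) p. 290 [cite: MochizukiEtTh2009, Cor 2.19 (ii) p.64].  Claim key `Mochizuki2012` (D-0012,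
DISPUTED); nothing here takes a side on [IUTchIII] Cor. 3.12.

PROVED: **`EtaleLevels.cor112_iii_model_genuine_of_cyclotomeTower`** — for ANY pointed inversion `I` with `D_{μ_-}` compact
(`hDc`), meeting `Ker ε` trivially (`hDq`), `ε(D_{μ_-})` of finite index, and the producer's inputs `ε`/(H1) `hΔ`/(H2) `hq` over a
base MLF `k ⊆ ℚ̄_p` finite over `ℚ_p`: given `hO : IsEtThOrigin` (F-2498) and `hΔΘ : IsCompact Δ_Θ` (GAP-LEDGER G-w5d187-1),
THERE IS a bijective change of coefficient cyclotome `cU : Λ(ℚ̄_pˣ) = Ẑ(1) ⥲ l·Δ_Θ` with `(mods M).red (cU ζ) = ζ_M` for all `M`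
such that the diagram `(†μ,×μ)` EXISTS for the model datum built with `cU` (canonical retractions from compactness) and the
GENUINE [AbsTopIII]-output data, with last arrow as in `cor112_iii_model_genuine`: `e` is a member iff for some member
`f : Π/Δ ⥲ G` of the full poly-isomorphism, `e` carries the class of `κ_D u` (`u ∈ 𝒪^×_{ℚ̄_p}`) to the class of `liftM(φ_f)(u)`.
GONE: `hcU` (and the datum `cU`), `hlift`, `hemb` (besides `hκ`, `hμ`, the Kummer identification, `hψA`, `hU`, `P₀`, `hOk`
discharged by abc-iut-w4-d043).  RESIDUAL NAMED INPUTS of [IUTchII] Cor. 1.12 (iii) at the model after this file: `hDq`, `hDc`,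
`[(D_{μ_-}.map ε).FiniteIndex]` ([SemiAnbd] §6 decomposition-group facts), `[T2Space G_{ℚ_p}]`, the producer's `ε`/(H1)/(H2),
`IsEtThOrigin`, `IsCompact Δ_Θ`, and the model data `mods`/`hmods`/`h15`/`L`/`hZ`/`hcharY`/`hlim` (`hlim` a theorem:
abc-iut-w4-d030's `bijective_rigidLimHom`).  Typed ≠ proved for those inputs; instantiated ≠ endorsed.
-/

noncomputable section

namespace Literature.IUT.HodgeArakelov

open CategoryTheory
open Literature.AnabelianGeometry.EtaleTheta Literature.AnabelianGeometry.SemiGraphs CohomologySystemOfContH1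
open Literature.AnabelianGeometry.AbsoluteAnabelian
open scoped Literature.AnabelianGeometry.EtaleTheta

namespace EtaleLevels

variable {p : ℕ} [Fact p.Prime] {D : Literature.AnabelianGeometry.EtaleTheta.ThetaSetting p}
  {E : D.EtaleThetaData} {l : ℕ} (C : E.DoubleUnderline l) (hC : D.Compat) (hS : D.Sec2Hyps)
  (hl : l.Prime) (hp2 : p ≠ 2) (hpl : p ≠ l) (hζ : ∃ ζ : D.K, IsPrimitiveRoot ζ (4 * l))
  (mods : ∀ M : ℕ+, D.CyclotomeMod l M)
  (f : contCocycles D.toTheta D.DeltaTheta C.GtpYdduu) (hf : f ∈ C.rootCocycles hC)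
  (hmods : ∀ (M M' : ℕ+) (h : (M : ℕ) ∣ (M' : ℕ)) (x : D.lDeltaTheta l),
    MuN.red p M M' h ((mods M').red x) = (mods M).red x)
  (h15 : Literature.AnabelianGeometry.EtaleTheta.ThetaSetting.Prop15iii E hC) (L : C.CuspLabels)
  (hZ : ∀ M : ℕ+, Nonempty (ModelCyclotomes.lDeltaQuot (C.rigidData (mods M) hC hS h15 L) ≃*
    Literature.IUT.HodgeTheaters.ZHat))
  (hcharY : EtaleThetaDataOfSetting.PiYddCharacteristic C)
  (hlim : Function.Bijective (rigidLimHom C hC hS hl hp2 hpl hζ mods f hf hmods h15 L hZ))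
  (Env : EnvOfGroup (setting C hC hS hl hp2 hpl hζ mods f hf)
    (modelSystem C hC hS hl hp2 hpl hζ mods f hf hmods h15 L hZ).PiX)
  (I : PointedInversion Env (thetaEnvData C hC hS hl hp2 hpl hζ mods f hf hmods h15 L hZ hcharY hlim).D)
  (hDq : ∀ d ∈ I.Dmu, EtaleThetaDataOfSetting.aug C d = 1 → d = 1)
  (hDc : IsCompact (I.Dmu : Set (modelSystem C hC hS hl hp2 hpl hζ mods f hf hmods h15 L hZ).PiX))
  (ρlim : (EtaleThetaDataOfSetting.coh C).lim ≃+ (EtaleThetaDataOfSetting.coh C).lim)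
  -- the base MLF `k ⊆ ℚ̄_p` with `k̄ = ℚ̄_p`, and the producer's inputs `ε`, (H1) `hΔ`, (H2) `hq`
  (k : Type) [Field k] [ValuativeRel k] [TopologicalSpace k] [IsNonarchimedeanLocalField k] [CharZero k]
  [Algebra k (PadicAlgCl p)] [IsAlgClosure k (PadicAlgCl p)]
  (ε : (setting C hC hS hl hp2 hpl hζ mods f hf).Gk ≃ₜ*
    (ModelMLFGaloisData.galois ({ k := k, K := PadicAlgCl p } : MLFClosure.{0}).k
      ({ k := k, K := PadicAlgCl p } : MLFClosure.{0}).K).tmPair.Pi)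
  (hΔ : ∀ φ : (setting C hC hS hl hp2 hpl hζ mods f hf).PiX ≃ₜ* (setting C hC hS hl hp2 hpl hζ mods f hf).PiX,
    (setting C hC hS hl hp2 hpl hζ mods f hf).DeltaX.map φ.toMulEquiv.toMonoidHom =
      (setting C hC hS hl hp2 hpl hζ mods f hf).DeltaX)
  (hq : Nonempty (TopGroup.quot (setting C hC hS hl hp2 hpl hζ mods f hf).PiX (setting C hC hS hl hp2 hpl hζ mods f hf).DeltaX ≃ₜ*
    (setting C hC hS hl hp2 hpl hζ mods f hf).Gk))

/-- **[IUTchII] Cor. 1.12 (iii) at the model with the GENUINE [AbsTopIII]-output data, `hcU` (and the datum `cU`), `hlift`,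
`hemb` DISCHARGED.**  For `k/ℚ_p` finite inside `ℚ̄_p`, ANY pointed inversion `I` with `D_{μ_-}` compact, the canonical
retractions of `ε` from compactness, constants `𝒪^×_{ℚ̄_p} ⊆ ℚ̄_pˣ` through `ε`, and abc-iut-L6-t13's genuine producer
`AbsTopMonoids.genuineOfModel` over `(k, ℚ̄_p)`: THERE IS a bijective change of coefficient cyclotome
`cU : Λ(ℚ̄_pˣ) = Ẑ(1) ⥲ l·Δ_Θ`, inverse to the model's identifications (`(mods M).red (cU ζ) = ζ_M`), such that the diagram
`(†μ,×μ)` of Cor. 1.12 (iii) EXISTS for the model datum built with `cU`, with last arrow the `α_×`-induced identifications read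
through the inverse Kummer identification (membership clause verbatim as in abc-iut-w4-d043's `cor112_iii_model_genuine`).
abc-iut-w4-d043's `cor112_iii_model_genuine_of_tower` with `hcU` := this seat's `exists_cyclotomeCoefficients_of_cyclotomeTower`
and `hlift`/`hemb` := `hlift_of_isCompact`/`hemb_of_isCompact`.  Residual named inputs: `hDq`, `hDc`,
`[(D_{μ_-}.map ε).FiniteIndex]`, `[T2Space G_{ℚ_p}]`, `ε`/`hΔ`/`hq`, `hO : IsEtThOrigin` (F-2498), `hΔΘ : IsCompact Δ_Θ`
(G-w5d187-1). [claim: Mochizuki2012, status: disputed] (IUTchII §1 Cor 1.12 (iii), kurims p.58) -/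
theorem cor112_iii_model_genuine_of_cyclotomeTower [T2Space (GQp p)]
    [Algebra ℚ_[p] k] [FiniteDimensional ℚ_[p] k] [IsScalarTower ℚ_[p] k (PadicAlgCl p)]
    [(Subgroup.map (EtaleThetaDataOfSetting.aug C) I.Dmu).FiniteIndex]
    (hO : D.IsEtThOrigin) (hΔΘ : IsCompact (D.DeltaTheta : Set D.GtpTheta))
    (G : IsoClass (setting C hC hS hl hp2 hpl hζ mods f hf).Gk) :
    ∃ cU : CyclotomeCoefficients (EtaleThetaDataOfSetting.phi C) (D.lDeltaTheta l) (PadicAlgCl p)ˣ,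
      Function.Bijective cU.hom ∧
      (∀ (ζ : Literature.AnabelianGeometry.EtaleTheta.cyclotome (PadicAlgCl p)ˣ) (M : ℕ+),
        (((mods M).red (cU.hom ζ) : MuN p M) : (PadicAlgCl p)ˣ) = (ζ : ℕ+ → (PadicAlgCl p)ˣ) M) ∧
      ∃ Δ : MuXmuDiagram
          (thetaEvaluation C hC hS hl hp2 hpl hζ mods f hf hmods h15 L hZ hcharY hlim Env I
            (LevelRetraction.ofAugmentation (EtaleThetaDataOfSetting.phi C) (D.lDeltaTheta l)
              (EtaleThetaDataOfSetting.aug C) I.Dmu hDq (EtaleThetaDataOfSetting.PiYdd C)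
              (EtaleThetaDataOfSetting.continuous_aug C) (aug_ker_acts_trivially C)
              (hlift_of_isCompact (EtaleThetaDataOfSetting.aug C) I.Dmu (EtaleThetaDataOfSetting.continuous_aug C) hDc)
              (hemb_of_isCompact (EtaleThetaDataOfSetting.aug C) I.Dmu (EtaleThetaDataOfSetting.continuous_aug C) hDc hDq))
            cU (EtaleThetaDataOfSetting.isOpen_stabilizer_units C) (EtaleThetaDataOfSetting.finiteIndex_stabilizer_units C)
            (unitGroup ℚ_[p] (PadicAlgCl p)) ρlim)
          (AbsTopMonoids.genuineOfModel (setting C hC hS hl hp2 hpl hζ mods f hf) { k := k, K := PadicAlgCl p } ε hΔ hq) G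
          ↥(AddCommGroup.torsion (thetaEnvData C hC hS hl hp2 hpl hζ mods f hf hmods h15 L hZ hcharY hlim).cohEnv.lim)
          (AddCommGroup.torsion (thetaEnvData C hC hS hl hp2 hpl hζ mods f hf hmods h15 L hZ hcharY hlim).cohEnv.lim).subtype,
        Δ.poly₄₅ = {e | ∃ φ : AbsTopMonoids.Genuine.qObj hq (IsoClass.base (setting C hC hS hl hp2 hpl hζ mods f hf).PiX) ⟶ G,
          ∀ (u : ↥(unitGroup ℚ_[p] (PadicAlgCl p)))
            (m : ↥(thetaEvaluation C hC hS hl hp2 hpl hζ mods f hf hmods h15 L hZ hcharY hlim Env I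
              (LevelRetraction.ofAugmentation (EtaleThetaDataOfSetting.phi C) (D.lDeltaTheta l)
                (EtaleThetaDataOfSetting.aug C) I.Dmu hDq (EtaleThetaDataOfSetting.PiYdd C)
                (EtaleThetaDataOfSetting.continuous_aug C) (aug_ker_acts_trivially C)
                (hlift_of_isCompact (EtaleThetaDataOfSetting.aug C) I.Dmu (EtaleThetaDataOfSetting.continuous_aug C) hDc)
                (hemb_of_isCompact (EtaleThetaDataOfSetting.aug C) I.Dmu (EtaleThetaDataOfSetting.continuous_aug C) hDc hDq))
              cU (EtaleThetaDataOfSetting.isOpen_stabilizer_units C) (EtaleThetaDataOfSetting.finiteIndex_stabilizer_units C)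
              (unitGroup ℚ_[p] (PadicAlgCl p)) ρlim).MxTM)
            (w : (nonzeroIntegers k (PadicAlgCl p))ˣ),
            (m : (thetaEvaluation C hC hS hl hp2 hpl hζ mods f hf hmods h15 L hZ hcharY hlim Env I
              (LevelRetraction.ofAugmentation (EtaleThetaDataOfSetting.phi C) (D.lDeltaTheta l)
                (EtaleThetaDataOfSetting.aug C) I.Dmu hDq (EtaleThetaDataOfSetting.PiYdd C)
                (EtaleThetaDataOfSetting.continuous_aug C) (aug_ker_acts_trivially C)
                (hlift_of_isCompact (EtaleThetaDataOfSetting.aug C) I.Dmu (EtaleThetaDataOfSetting.continuous_aug C) hDc)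
                (hemb_of_isCompact (EtaleThetaDataOfSetting.aug C) I.Dmu (EtaleThetaDataOfSetting.continuous_aug C) hDc hDq))
              cU (EtaleThetaDataOfSetting.isOpen_stabilizer_units C) (EtaleThetaDataOfSetting.finiteIndex_stabilizer_units C)
              (unitGroup ℚ_[p] (PadicAlgCl p)) ρlim).Hd) =
                Multiplicative.toAdd (h1LimKummer (EtaleThetaDataOfSetting.phi C) (D.lDeltaTheta l) I.Dmu cU
                  (EtaleThetaDataOfSetting.isOpen_stabilizer_units C) (EtaleThetaDataOfSetting.finiteIndex_stabilizer_units C)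
                  u) →
            ((w : nonzeroIntegers k (PadicAlgCl p)) : PadicAlgCl p) = ((u : (PadicAlgCl p)ˣ) : PadicAlgCl p) →
              e (Multiplicative.ofAdd (QuotientAddGroup.mk m)) =
                QuotientGroup.mk (Units.map (AbsTopMonoids.Genuine.liftM ({ k := k, K := PadicAlgCl p } : MLFClosure.{0})
                  (AbsTopMonoids.Genuine.phiOf ({ k := k, K := PadicAlgCl p } : MLFClosure.{0}) ε φ)).toMonoidHom w)} := by
  -- the chain tower carrying the model's identifications, and the coefficient iso built from it
  obtain ⟨cU, hcU, hlev⟩ := EtaleThetaDataOfSetting.exists_cyclotomeCoefficients_of_cyclotomeTower C hO hΔΘ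
    (cyclotomeTower mods hmods (dvd_refl ((1 : ℕ+) : ℕ)))
  refine ⟨cU, hcU, fun ζ M => ?_, ?_⟩
  · -- the chain tower's all-level identification at `M` is `mods M` (compatibility `hmods`)
    have hmod : ((cyclotomeTower mods hmods (dvd_refl ((1 : ℕ+) : ℕ))).modAll M).red (cU.hom ζ) =
        (mods M).red (cU.hom ζ) := by
      rw [ThetaSetting.CyclotomeTower.modAll_red, ThetaSetting.CyclotomeTower.redVia_apply]
      exact hmods M _ _ (cU.hom ζ)
    rw [← hmod]
    exact hlev ζ M
  · exact cor112_iii_model_genuine_of_tower C hC hS hl hp2 hpl hζ mods f hf hmods h15 L hZ hcharY hlim Env I hDq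
      (hlift_of_isCompact (EtaleThetaDataOfSetting.aug C) I.Dmu (EtaleThetaDataOfSetting.continuous_aug C) hDc)
      (hemb_of_isCompact (EtaleThetaDataOfSetting.aug C) I.Dmu (EtaleThetaDataOfSetting.continuous_aug C) hDc hDq)
      cU ρlim k ε hΔ hq hcU G

end EtaleLevels

end Literature.IUT.HodgeArakelov

end
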